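import Summits.NavierStokesRegularity.NavierStokesRegularity.Theorems.ExtremiserTransienceNearExtremalTransiencePerFlowOfPorousZone
import HarnessLib

/-!
# Crux `NearExtremalTransiencePerFlow` (stmt-NavierStokesRegularity-26567) — HEART DEFINITIONS SKETCH (ns-idea-5 g12, design only)

NO SUMMIT IS PROVED BY A LINE, and this file proves nothing: it TYPES the vocabulary that the heart plan of the two registered g12 lines
(`Lines/transience_exit.md` rev 3 §«Heart plan for X»: S♯ + LC + D; `Lines/depleted_fraction.md` rev 3) needs for its CRYSTAL branch D-C,
so that g13 / a typer can file them as DEFINITION requests and support statements.  Nothing here is registered as a stub; nothing here is a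
route item.  Every `def … : Prop` below is a candidate statement with its why-might-fail in `HeartDefs.md`.

The objects: lattice-periodic smooth divergence-free fields on `ℝ³` (period `L` in each coordinate direction), their CELL functionals
(stretching `J`, enstrophy `Z`, palinstrophy `P` over one period cell), the periodic admissible-constant set and the PERIODIC DEPLETION
CONSTANT `kStarPer L := sInf (udcSetPer L)` — the exact analogue of the tree's `kStar := sInf udcSet`
(`Theorems/ExtremiserTransienceKStarAttainedHalfSpaceVariation.lean`), stated with the SAME pointwise objects (`curl`, `fderiv`,
`frobeniusNormSq`) as the crux, so that no torus dictionary is needed.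
-/

noncomputable section

set_option linter.dupNamespace false

open scoped Topology InnerProductSpace RealInnerProductSpace ENNReal ContDiff Laplacian
open MeasureTheory Filter Set Metric
open Literature.Analysis.FluidPDE
open Summit.NavierStokesRegularity.NavierStokesRegularity.Theses.ExtremiserTransience
open Summit.NavierStokesRegularity.NavierStokesRegularity.Theorems
open Summit.NavierStokesRegularity.NavierStokesRegularity.Theorems.DepletionLadder.KStar.HalfSpace

namespace Summit.NavierStokesRegularity.NavierStokesRegularity.Cruxes.NearExtremalTransiencePerFlow.HeartDefs

local notation "E3" => EuclideanSpace ℝ (Fin 3)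

/-! ## D1 · Lattice-periodic fields and cell functionals -/

/-- `v` is `L`-periodic in each of the three coordinate directions (cubic lattice `L ℤ³`). -/
def IsLatticePeriodic (L : ℝ) (v : E3 → E3) : Prop :=
  ∀ (x : E3) (i : Fin 3), v (x + EuclideanSpace.single i L) = v x

/-- The half-open period cell `[0, L)³`. -/
def cell (L : ℝ) : Set E3 := {x | ∀ i : Fin 3, x i ∈ Set.Ico (0 : ℝ) L}

/-- Cell stretching `J_cell(v) = ∫_{[0,L)³} ⟪ω, (∇v) ω⟫`, `ω = curl v`. -/
def JstCell (L : ℝ) (v : E3 → E3) : ℝ := ∫ x in cell L, ⟪curl v x, fderiv ℝ v x (curl v x)⟫_ℝ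

/-- Cell enstrophy `Z_cell(v) = ∫_{[0,L)³} |ω|²`. -/
def ZenCell (L : ℝ) (v : E3 → E3) : ℝ := ∫ x in cell L, ‖curl v x‖ ^ 2

/-- Cell palinstrophy `P_cell(v) = ∫_{[0,L)³} |∇ω|²`. -/
def WpaCell (L : ℝ) (v : E3 → E3) : ℝ := ∫ x in cell L, frobeniusNormSq (fderiv ℝ (curl v) x)

/-- The set of PERIODIC admissible depletion constants: `κ` such that `|J_cell| ≤ κ · M · √Z_cell · √P_cell` for every smooth,
divergence-free, `L`-periodic field bounded by `M`.  (No integrability hypotheses: the cell is bounded and the field smooth.  Constant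
backgrounds are allowed, as in the whole-space set `udcSet`, where `M` is any bound of `‖v‖`.) -/
def udcSetPer (L : ℝ) : Set ℝ :=
  {κ : ℝ | ∀ (v : E3 → E3) (M : ℝ), ContDiff ℝ (⊤ : ℕ∞) v → VectorCalculus.IsDivFree v → IsLatticePeriodic L v →
    (∀ x, ‖v x‖ ≤ M) → |JstCell L v| ≤ κ * M * Real.sqrt (ZenCell L v) * Real.sqrt (WpaCell L v)}

/-- The PERIODIC depletion constant `κ_per(L) := inf udcSetPer L` (analogue of `kStar := sInf udcSet`). -/
def kStarPer (L : ℝ) : ℝ := sInf (udcSetPer L)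

/-! ## L1–L3 · Support statements relating `κ_per` to `κ⋆` (candidate SUPPORT items; M-sized; why-might-fail in `HeartDefs.md`) -/

/-- L1 (localisation): every whole-space admissible constant is periodic-admissible, hence `κ_per(L) ≤ κ⋆`.  Proof idea: truncate an
`L`-periodic field to `N³` cells with a divergence-free cutoff (Bogovskiĭ correction on the boundary layer of unit-cell width); bulk
functionals are `N³ ×` cell functionals, the layer contributes `O(N²)`, the sup grows by `o(1)`; let `N → ∞`. -/
def KStarPerLeKStar : Prop := ∀ L : ℝ, 0 < L → udcSet ⊆ udcSetPer L

/-- L2 (periodisation): every periodic-admissible constant is whole-space admissible, hence `κ⋆ ≤ κ_per(L)`.  Proof idea: a rapidly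
decaying admissible field restricted to a large cell and periodised changes `J, Z, P, sup` by `o(1)` as the cell grows; combine with L3. -/
def KStarLeKStarPer : Prop := ∀ L : ℝ, 0 < L → udcSetPer L ⊆ udcSet

/-- L3 (scale freedom): the cell quotient is invariant under `v ↦ v(·/λ)` (`J ↦ J`, `Z ↦ λ Z`, `P ↦ P/λ`, `sup ↦ sup` after the cell
rescales), so the admissible sets do not depend on the period. -/
def UdcSetPerScaleFree : Prop := ∀ L L' : ℝ, 0 < L → 0 < L' → udcSetPer L = udcSetPer L'

/-- Consequence of L1 ∧ L2 (recorded as the target equality the instruments g10–g12 silently used: torus quotients bound `κ⋆` from below). -/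
def KStarPerEqKStar : Prop := ∀ L : ℝ, 0 < L → kStarPer L = kStar

theorem kStarPerEqKStar_of (h₁ : KStarPerLeKStar) (h₂ : KStarLeKStarPer) : KStarPerEqKStar := by
  intro L hL
  have hset : udcSetPer L = udcSet := Set.Subset.antisymm (h₂ L hL) (h₁ L hL)
  simp [kStarPer, kStar, hset]

/-! ## D2–D3 · Periodic extremals («crystals») and their attainment -/

/-- D2: an EXACT PERIODIC EXTREMAL (crystal) of period `L`: smooth, divergence-free, `L`-periodic, non-trivial vorticity, and equality in
the sharp periodic inequality with the honest height `M = sup ‖v‖` (the `sSup` of the range; finite for a continuous periodic field). -/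
def IsPerExtremal (L : ℝ) (v : E3 → E3) : Prop :=
  ContDiff ℝ (⊤ : ℕ∞) v ∧ VectorCalculus.IsDivFree v ∧ IsLatticePeriodic L v ∧ 0 < ZenCell L v ∧
    |JstCell L v| = kStarPer L * (sSup (Set.range fun x => ‖v x‖)) * Real.sqrt (ZenCell L v) * Real.sqrt (WpaCell L v)

/-- D3 (attainment on the torus — OPEN, a genuine statement, not a definition): some period carries a crystal.  Why it might fail:
maximising sequences on a fixed torus may concentrate to a point (the tight branch: a whole-space extremal) or lose vorticity
(`Z_cell → 0`, the caloric/small-amplitude branch); see `HeartDefs.md` §Branches. -/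
def PerExtremalExists : Prop := ∃ L : ℝ, 0 < L ∧ ∃ v : E3 → E3, IsPerExtremal L v

/-! ## D4 · The crystal branch D-C of the heart, typed: no Navier–Stokes arc of exact crystals -/

/-- D4 (D-C exact, `ν = 1` by scaling): there is NO classical space-periodic Navier–Stokes solution on a time interval `[0, τ]`, `τ > 0`,
every slice of which is an exact periodic extremal.  (`IsClassicalNSSolutionOn` is the whole-space pointwise predicate of
`Literature/Analysis/FluidPDE/ClassicalSolution.lean` — smooth + momentum + div-free, no decay — so periodic solutions qualify; the
pressure is any smooth `p`.)  This is the `ε = 0` core of both hearts X / X♭ in the crystal branch; its whole-space decaying sibling is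
already the theorem `slice_lt_sharp` (tree), its vacuum sibling is `not_hasVacuumGerm_of_typeIAncientMild` (tree). -/
def NoPerExtremalNSArc : Prop :=
  ∀ (L τ : ℝ), 0 < L → 0 < τ → ∀ (U : ℝ → E3 → E3) (p : ℝ → E3 → ℝ),
    IsClassicalNSSolutionOn (Set.Icc 0 τ) 1 0 U p → (∀ t ∈ Set.Icc 0 τ, IsLatticePeriodic L (U t)) →
    (∀ t ∈ Set.Icc 0 τ, IsPerExtremal L (U t)) → False

/-- D4♭ (the quantitative torus heart — the periodic analogue of X♭ `DepletedFraction`, stated WITHOUT the Taylor lock, which on a fixed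
torus is replaced by the period): at fixed period, height bound `H` and initial gradient bound `G`, a uniform `ε > 0` such that along
every periodic classical NS arc on `[0, τ₁]` (`ν = 1`) the `ε`-DEPLETED times occupy at least an `ε`-fraction of `[0, τ₁]`.
By compactness of bounded-gradient periodic NS arcs (parabolic smoothing) this should reduce to D4 ∧ (closedness of near-extremality
under smooth limits away from `Z_cell → 0`) ∧ (the caloric branch: no extremal ARC of the Stokes/heat flow among `Z_cell → 0`
renormalised limits) — see `HeartDefs.md` §Branches; that reduction is itself a candidate support statement, not claimed here. -/
def PerDepletedFraction : Prop :=
  ∀ (L H G τ₁ : ℝ), 0 < L → 0 < H → 0 < G → 0 < τ₁ → ∃ ε : ℝ, 0 < ε ∧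
    ∀ (U : ℝ → E3 → E3) (p : ℝ → E3 → ℝ),
      IsClassicalNSSolutionOn (Set.Icc 0 τ₁) 1 0 U p → (∀ t ∈ Set.Icc 0 τ₁, IsLatticePeriodic L (U t)) →
      (∀ t ∈ Set.Icc 0 τ₁, ∀ x, ‖U t x‖ ≤ H) → (∀ x, ‖fderiv ℝ (U 0) x‖ ≤ G) →
      ENNReal.ofReal (ε * τ₁) ≤
        volume ({t : ℝ | ∀ M : ℝ, (∀ x, ‖U t x‖ ≤ M) →
          |JstCell L (U t)| ≤ (kStarPer L - ε) * M * Real.sqrt (ZenCell L (U t)) * Real.sqrt (WpaCell L (U t))} ∩ Set.Icc 0 τ₁)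

/-! ## D5 · The caloric (small-amplitude) branch, typed -/

/-- D5: no non-trivial periodic field stays exactly extremal along the HEAT FLOW for a time interval — the `Z_cell → 0` (linearised)
sibling of D4.  Stated through any smooth periodic solution `W` of the vector heat equation `∂_t W = ΔW` (no NS structure).  Why it might
fail: a single-Fourier-shell field is heat-flow self-similar (`W(t) = e^{-|k|²t} W(0)`, quotient constant in `t`), so D5 holds iff NO
single-shell field is a periodic extremal — open; see `HeartDefs.md`. -/
def NoPerExtremalCaloricArc : Prop :=
  ∀ (L τ : ℝ), 0 < L → 0 < τ → ∀ (W : ℝ → E3 → E3),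
    (∀ t ∈ Set.Icc 0 τ, IsLatticePeriodic L (W t)) → (∀ t ∈ Set.Icc 0 τ, ContDiff ℝ (⊤ : ℕ∞) (W t)) →
    (∀ t ∈ Set.Icc 0 τ, ∀ x, HasDerivWithinAt (fun s => W s x) ((Δ (W t)) x) (Set.Icc 0 τ) t) →
    (∀ t ∈ Set.Icc 0 τ, IsPerExtremal L (W t)) → False

/-! ## F · MINED IDENTITIES (g12, extremal-example mining — rigorous on paper, typed here as SUPPORT statements; proofs = periodic
integration by parts).  Source computation: `heart/mono_mining.py`, `heart/width_check.py` (pure python, exact Fourier algebra; folder of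
ns-idea-5 g12) found `J = 0` for EVERY single-shell field, which is the theorem F6 below; F7 is its quantitative form.

F6 (Lamb form of stretching).  For smooth divergence-free periodic `v`, `ω = curl v`:
`curl (ω × v) = (v·∇)ω − (ω·∇)v`, hence `J = ∫⟪ω,(ω·∇)v⟫ = −∫⟪ω, curl(ω × v)⟫ = −∫⟪curl ω, ω × v⟫`, and since `ω × v ⊥ ω, v` pointwise,
`J = −∫⟪curl ω − μ ω − λ v, ω × v⟫` for ALL real `λ, μ`.  With `‖ω × v‖₂ ≤ M √Z` and `‖curl ω‖₂ = ‖Δv‖₂ = √P`: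
F7 (defect bound).  `|J| ≤ M · √Z · min_{λ,μ} ‖curl curl v − μ curl v − λ v‖₂`, i.e. the depletion QUOTIENT is at most the relative
`L²`-distance of `curl curl v = −Δv` from `span{v, curl v}` («double-Beltrami defect»); in particular (μ = 0) at most the relative SPECTRAL
WIDTH `min_λ ‖Δv + λv‖₂/‖Δv‖₂`, and `J = 0` for every MONOCHROMATIC field (`−Δv = λv`) and every BELTRAMI field (`curl v = μv`).
Consequence for the heart: a `(κ⋆ − ε)`-near-extremal slice has double-Beltrami defect `≥ κ⋆ − ε ≥ 0.12` (certified `κ⋆ ≥ 0.1247`): near-extremal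
fields are spectrally BROAD and far from the Beltrami hierarchy — the opposite of «Beltramised» depleted regions.  D5's feared obstruction
(a heat-flow self-similar = monochromatic crystal) is therefore IMPOSSIBLE: monochromatic fields have quotient 0. -/

/-- F7 (periodic): the double-Beltrami DEFECT BOUND for the cell stretching. -/
def CellStretchDefectBound : Prop :=
  ∀ (L : ℝ) (v : E3 → E3) (M lam mu : ℝ), 0 < L → ContDiff ℝ (⊤ : ℕ∞) v → VectorCalculus.IsDivFree v → IsLatticePeriodic L v →
    (∀ x, ‖v x‖ ≤ M) →
    |JstCell L v| ≤ M * Real.sqrt (ZenCell L v) *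
      Real.sqrt (∫ x in cell L, ‖curl (curl v) x - mu • curl v x - lam • v x‖ ^ 2)

/-- F6a (periodic): MONOCHROMATIC fields (eigenfields of `curl ∘ curl = −Δ` on divergence-free fields) do not stretch: `J_cell = 0`.
(The height bound `M` is a convenience hypothesis — continuous periodic fields are bounded — so that F6a is F7 with `μ = 0` on the nose.) -/
def MonochromaticNoStretch : Prop :=
  ∀ (L : ℝ) (v : E3 → E3) (M lam : ℝ), 0 < L → ContDiff ℝ (⊤ : ℕ∞) v → VectorCalculus.IsDivFree v → IsLatticePeriodic L v →
    (∀ x, ‖v x‖ ≤ M) → (∀ x, curl (curl v) x = lam • v x) → JstCell L v = 0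

/-- F6b (periodic): BELTRAMI fields (`curl v = μ v`) do not stretch (F7 with `λ = 0`, since then `curl curl v = μ curl v`). -/
def BeltramiNoStretch : Prop :=
  ∀ (L : ℝ) (v : E3 → E3) (M mu : ℝ), 0 < L → ContDiff ℝ (⊤ : ℕ∞) v → VectorCalculus.IsDivFree v → IsLatticePeriodic L v →
    (∀ x, ‖v x‖ ≤ M) → (∀ x, curl v x = mu • v x) → JstCell L v = 0

theorem monochromaticNoStretch_of_defect (h : CellStretchDefectBound) : MonochromaticNoStretch := by
  intro L v M lam hL hs hd hp hM hmono
  have hb := h L v M lam 0 hL hs hd hp hM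
  have hz : (∫ x in cell L, ‖curl (curl v) x - (0 : ℝ) • curl v x - lam • v x‖ ^ 2) = 0 := by simp [hmono]
  rw [hz, Real.sqrt_zero, mul_zero] at hb
  exact abs_eq_zero.mp (le_antisymm hb (abs_nonneg _))

/-- F7 (whole space, the crux's own class `udcSet`): the same defect bound with the whole-space integrals — every slice whose
`−Δv` is `L²`-close to `span{v, curl v}` relative to `‖Δv‖₂` is automatically DEPLETED below `κ⋆`. -/
def StretchDefectBound : Prop :=
  ∀ (v : E3 → E3) (M B lam mu : ℝ), ContDiff ℝ (⊤ : ℕ∞) v → VectorCalculus.IsDivFree v → (∀ x, ‖v x‖ ≤ M) → (∀ x, ‖fderiv ℝ v x‖ ≤ B) →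
    (∫⁻ x, ‖iteratedFDeriv ℝ 0 v x‖ₑ ^ 2 < ⊤) → (∫⁻ x, ‖iteratedFDeriv ℝ 1 v x‖ₑ ^ 2 < ⊤) → (∫⁻ x, ‖iteratedFDeriv ℝ 2 v x‖ₑ ^ 2 < ⊤) →
    |∫ x, ⟪curl v x, fderiv ℝ v x (curl v x)⟫_ℝ| ≤
      M * Real.sqrt (∫ x, ‖curl v x‖ ^ 2) * Real.sqrt (∫ x, ‖curl (curl v) x - mu • curl v x - lam • v x‖ ^ 2)

end Summit.NavierStokesRegularity.NavierStokesRegularity.Cruxes.NearExtremalTransiencePerFlow.HeartDefs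

end
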